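import Summits.Ventures.Crystal3D.Theorems.StickyWulffConstantPolycrystalWulffBoundRungSingleAxisCharge
import Summits.Ventures.Crystal3D.Theorems.StickyWulffConstantPolycrystalWulffBoundTwinSupportGap
import Summits.Ventures.Crystal3D.Theorems.StickyWulffConstantPolycrystalWulffBoundTwinBodyChange

/-!
# `PolycrystalWulffBound`, line `PolyDensity`: the HYBRID single-axis rung — slide on RELABELLED frames
# plus the sharp twin body change (crux `stmt-Ventures-19482`)

Route `StickyWulffConstant` of the venture `Summits/Ventures/Crystal3D`, second prover lane (poly-p2,
gen 11).  The general single-axis rung (`rung_singleAxis_texture`, gen 10) charges EVERY twin wall by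
the slide `(2/√6)|⟪w, ν⟫|`; its residual at the law's `½` is the azimuth-balanced `⟨112⟩`-normal class
(`W_min` centre cones; Knothe-flag LP ceiling `0.544`).  Here the slide rung is applied to RELABELLED
frames `A'` (every `A' f` is one of the texture's frames; `A' = A` off a set `T` of "flipped" grains):
the cell/grain rung sees only the walls between different RELABELLED classes, and the price of flipping
grain `f` is the sharp twin body change `Fr(A') ≤ Fr(A) + (1/√6)·Σ_{f ∈ T} Fr_{Dsc m₀}(f)`
(`freeEnergy_bodyChange_le_add` with the gap `supportFn_le_twin_disc`: `(1/√6)·sin∠(ν, m₀)` per unit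
FREE area, the thin-plate constant, nothing on walls).  RESULT (`rung_singleAxis_texture_hybrid`): a crux
texture `Tex n G A c m` presented by cells, all frames `Ax m₀`, Bool lattice labels `τ`, wall data
`m f g = m₀` across the classes, three admissible (bond, `⟨112⟩`) pairs, and ANY relabelling
`(A', τ', T)` passing the HYBRID TEST

  `(2/√6)·( Σ_{τ' f ≠ τ' g} Σ_{a ∈ s f, b ∈ s g} |⟪w, ν_ab⟫|·fa  +  Σ_{f ∈ T} Fr_{Dsc m₀}(f) )
      ≤ ½ · Σ_{τ f ≠ τ g} Σ_{a, b} √(1 − ⟪ν_ab, m₀⟫²)·fa`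

satisfies `6·2^{1/3}(√2·Vol)^{2/3} ≤ En n G A c m`.  `T = ∅, A' = A` is the gen-10 rung; flipping ALL
grains of one class (`rung_singleAxis_texture_flipClass`) needs NO azimuth condition:
`(2/√6)·Σ_{class} Fr_{Dsc m₀} ≤ ½·Σ_{twin walls}` — this covers the named residual exemplar (the `W_min`
centre-cone texture: sin-weighted free area of one class ≈ 22, walls ≈ 33) and every texture whose twin
walls outweigh `(2/√6)×` the sin-weighted free area of its minority class.
WHAT THIS IS NOT: the residual of the hybrid test (several thick lamellar grains of BOTH classes whose few
non-basal walls are balanced over the three azimuths at small tilt); multi-axis colonies; the crux is not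
claimed.
-/

noncomputable section

open scoped BigOperators InnerProductSpace ENNReal Pointwise
open MeasureTheory Filter Set

namespace Summit.Ventures.Crystal3D.Cruxes.PolycrystalWulffBound.PolyDensity

open Summit.Ventures.Crystal3D.Theorems
open Summit.Ventures.Crystal3D.Cruxes.TextureLiminf.TexShadow (per polytope facetArea supportFn E3
  PolytopeCalculus stub_polytopeCalculus)
open Literature.MathematicalPhysics.StatisticalMechanics (fccStacking barlowStacking IsHaggSeq perimeter)

/-- **Hybrid single-axis rung** (`rung_singleAxis_texture_hybrid`): slide rung on relabelled frames +
sharp twin body change.  See the module docstring. -/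
theorem rung_singleAxis_texture_hybrid :
    let Λ : Set (EuclideanSpace ℝ (Fin 3)) := Literature.MathematicalPhysics.StatisticalMechanics.fccStacking 1 (Real.sqrt (2 / 3));
    let Brl : (ℤ → ℤ) → Set (EuclideanSpace ℝ (Fin 3)) := Literature.MathematicalPhysics.StatisticalMechanics.barlowStacking 1 (Real.sqrt (2 / 3));
    let Ax : EuclideanSpace ℝ (Fin 3) → (EuclideanSpace ℝ (Fin 3) ≃ₗᵢ[ℝ] EuclideanSpace ℝ (Fin 3)) → (EuclideanSpace ℝ (Fin 3) ≃ₗᵢ[ℝ] EuclideanSpace ℝ (Fin 3)) → Prop := fun m A B => ∃ (L : EuclideanSpace ℝ (Fin 3) ≃ₗᵢ[ℝ] EuclideanSpace ℝ (Fin 3)) (s₁ s₂ : EuclideanSpace ℝ (Fin 3)) (σ σ' : ℤ → ℤ), Literature.MathematicalPhysics.StatisticalMechanics.IsHaggSeq σ ∧ Literature.MathematicalPhysics.StatisticalMechanics.IsHaggSeq σ' ∧ L (EuclideanSpace.single (2 : Fin 3) (1 : ℝ)) = m ∧ A '' Λ ⊆ (fun q => L q + s₁) '' Brl σ ∧ B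 '' Λ ⊆ (fun q => L q + s₂) '' Brl σ';
    let CoAx : (EuclideanSpace ℝ (Fin 3) ≃ₗᵢ[ℝ] EuclideanSpace ℝ (Fin 3)) → (EuclideanSpace ℝ (Fin 3) ≃ₗᵢ[ℝ] EuclideanSpace ℝ (Fin 3)) → Prop := fun A B => ∃ m, Ax m A B;
    let Φ : EuclideanSpace ℝ (Fin 3) → ℝ := fun ν => Real.sqrt 2 / 4 * ∑ᶠ w ∈ {w ∈ Λ | ‖w‖ = 1}, |⟪w, ν⟫_ℝ|;
    let Per : Set (EuclideanSpace ℝ (Fin 3)) → Set (EuclideanSpace ℝ (Fin 3)) → ℝ := fun K S => (⨆ (ξ : EuclideanSpace ℝ (Fin 3) → EuclideanSpace ℝ (Fin 3)) (_ : ContDiff ℝ 1 ξ ∧ HasCompactSupport ξ ∧ ∀ z, ξ z ∈ K), ENNReal.ofReal (∫ z in S, Literature.MathematicalPhysics.StatisticalMechanics.fieldDivergence ξ z)).toReal;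
    let ι : Set (EuclideanSpace ℝ (Fin 3)) → Set (EuclideanSpace ℝ (Fin 3)) → Set (EuclideanSpace ℝ (Fin 3)) → ℝ := fun K S₁ S₂ => (Per K S₁ + Per K S₂ - Per K (S₁ ∪ S₂)) / 2;
    let W : (EuclideanSpace ℝ (Fin 3) ≃ₗᵢ[ℝ] EuclideanSpace ℝ (Fin 3)) → Set (EuclideanSpace ℝ (Fin 3)) := fun A => {y | ∀ ν : EuclideanSpace ℝ (Fin 3), ⟪y, ν⟫_ℝ ≤ Φ (A.symm ν)};
    let Dsc : EuclideanSpace ℝ (Fin 3) → Set (EuclideanSpace ℝ (Fin 3)) := fun m => {y | ‖y‖ ≤ 1 ∧ ⟪y, m⟫_ℝ = 0};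
    let Tex : (n : ℕ) → (Fin n → Set (EuclideanSpace ℝ (Fin 3))) → (Fin n → (EuclideanSpace ℝ (Fin 3) ≃ₗᵢ[ℝ] EuclideanSpace ℝ (Fin 3))) → (Fin n → Fin n → ℝ) → (Fin n → Fin n → EuclideanSpace ℝ (Fin 3)) → Prop := fun n G A c m => (∀ f : Fin n, Literature.MathematicalPhysics.StatisticalMechanics.HasFinitePerimeter (G f) ∧ volume (G f) < ⊤) ∧ (∀ f g, f ≠ g → Disjoint (G f) (G g)) ∧ (∀ f g, f ≠ g → 0 ≤ c f g) ∧ (∀ f g, f ≠ g → ¬ CoAx (A f) (A g) → m f g = 0 ∧ 1 ≤ c f g) ∧ (∀ f g, f ≠ g → CoAx (A f) (A g) → A f '' Λ ≠ A g '' Λ → Ax (m f g) (A f) (A g) ∧ 1 / 2 ≤ c f g);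
    let En : (n : ℕ) → (Fin n → Set (EuclideanSpace ℝ (Fin 3))) → (Fin n → (EuclideanSpace ℝ (Fin 3) ≃ₗᵢ[ℝ] EuclideanSpace ℝ (Fin 3))) → (Fin n → Fin n → ℝ) → (Fin n → Fin n → EuclideanSpace ℝ (Fin 3)) → ℝ := fun n G A c m => ∑ f : Fin n, Per (W (A f)) (G f) - ∑ f, ∑ g, (if f = g then 0 else ι (W (A f)) (G f) (G g)) + ∑ f, ∑ g, (if f = g then 0 else c f g / 2 * ι (Dsc (m f g)) (G f) (G g));
    let Vol : (n : ℕ) → (Fin n → Set (EuclideanSpace ℝ (Fin 3))) → ℝ := fun n G => (volume (⋃ f : Fin n, G f)).toReal;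
    ∀ (k' : ℕ) (Hc : Fin k' → Finset ((EuclideanSpace ℝ (Fin 3)) × ℝ)) (nv : Fin k' → Fin k' → EuclideanSpace ℝ (Fin 3)),
      (∀ j, Bornology.IsBounded (polytope (Hc j))) →
      (∀ j j', j ≠ j' → Disjoint (polytope (Hc j)) (polytope (Hc j'))) →
      (∀ i j, nv j i = -nv i j) →
      (∀ j j', j ≠ j' → ‖nv j j'‖ = 1 ∧ ∃ b : ℝ,
        closure (polytope (Hc j)) ∩ closure (polytope (Hc j')) ⊆ {x | ⟪nv j j', x⟫_ℝ = b}) →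
    ∀ (n : ℕ) (G : Fin n → Set (EuclideanSpace ℝ (Fin 3)))
      (A : Fin n → (EuclideanSpace ℝ (Fin 3) ≃ₗᵢ[ℝ] EuclideanSpace ℝ (Fin 3)))
      (c : Fin n → Fin n → ℝ) (m : Fin n → Fin n → EuclideanSpace ℝ (Fin 3)),
      Tex n G A c m →
    ∀ (s : Fin n → Finset (Fin k')),
      (∀ f, G f = ⋃ j ∈ s f, polytope (Hc j)) →
      (∀ f g, f ≠ g → Disjoint (s f) (s g)) →
      (∀ j, ∃ f, j ∈ s f) →
    ∀ (τ : Fin n → Bool), (∀ f g, τ f = τ g → A f '' Λ = A g '' Λ) → (∀ f g, τ f ≠ τ g → A f '' Λ ≠ A g '' Λ) →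
    ∀ (m₀ u w : EuclideanSpace ℝ (Fin 3)), (∀ f g, Ax m₀ (A f) (A g)) → (∀ f g, f ≠ g → τ f ≠ τ g → m f g = m₀) →
      ‖u‖ = 1 → ‖w‖ = 1 → ⟪u, m₀⟫_ℝ = 0 → ⟪w, m₀⟫_ℝ = 0 → ⟪w, u⟫_ℝ = 0 →
      (∀ f, u ∈ A f '' Λ) → (∀ f, (ℝ ∙ u)ᗮ.reflection '' (A f '' Λ) = A f '' Λ) →
    ∀ (u₂ w₂ u₃ w₃ : EuclideanSpace ℝ (Fin 3)),
      w₂ = (Real.sqrt 3 / 2) • u - (1 / 2 : ℝ) • w → w₃ = -(Real.sqrt 3 / 2) • u - (1 / 2 : ℝ) • w →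
      ‖u₂‖ = 1 → ⟪u₂, m₀⟫_ℝ = 0 → ⟪w₂, u₂⟫_ℝ = 0 →
      (∀ f, u₂ ∈ A f '' Λ) → (∀ f, (ℝ ∙ u₂)ᗮ.reflection '' (A f '' Λ) = A f '' Λ) →
      ‖u₃‖ = 1 → ⟪u₃, m₀⟫_ℝ = 0 → ⟪w₃, u₃⟫_ℝ = 0 →
      (∀ f, u₃ ∈ A f '' Λ) → (∀ f, (ℝ ∙ u₃)ᗮ.reflection '' (A f '' Λ) = A f '' Λ) →
    ∀ (A' : Fin n → (EuclideanSpace ℝ (Fin 3) ≃ₗᵢ[ℝ] EuclideanSpace ℝ (Fin 3))) (τ' : Fin n → Bool) (T : Finset (Fin n)),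
      (∀ f, f ∉ T → A' f = A f) → (∀ f, ∃ g, A' f = A g) → (∀ f g, τ' f = τ' g → A' f '' Λ = A' g '' Λ) →
      2 / Real.sqrt 6 * ((∑ f, ∑ g, (if τ' f = τ' g then 0 else ∑ a ∈ s f, ∑ b ∈ s g,
          |⟪w, nv a b⟫_ℝ| * facetArea (closure (polytope (Hc a)) ∩ closure (polytope (Hc b))) (nv a b))) +
        ∑ f ∈ T, (Per (Dsc m₀) (G f) - ∑ g, (if f = g then 0 else ι (Dsc m₀) (G f) (G g)))) ≤
        1 / 2 * ∑ f, ∑ g, (if τ f = τ g then 0 else ∑ a ∈ s f, ∑ b ∈ s g,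
          Real.sqrt (1 - ⟪nv a b, m₀⟫_ℝ ^ 2) * facetArea (closure (polytope (Hc a)) ∩ closure (polytope (Hc b))) (nv a b)) →
    6 * (2 : ℝ) ^ ((1 : ℝ) / 3) * (Real.sqrt 2 * Vol n G) ^ ((2 : ℝ) / 3) ≤ En n G A c m := by
  intro Λ Brl Ax CoAx Φ Per ι W Dsc Tex En Vol k' Hc nv hbd hdisjQ hanti hplane n G A c m hTex
    s hGs hsdisj hcov τ hτ1 hτ2 m₀ u w hAx hmax hu hw hum hwm hwu hbond hmir
    u₂ w₂ u₃ w₃ hw₂ hw₃ hu₂ hu₂m hwu₂ hbond₂ hmir₂ hu₃ hu₃m hwu₃ hbond₃ hmir₃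
    A' τ' T hA'T hA'mem hτ'1 hHyb
  classical
  have hTex' := hTex
  obtain ⟨hfin, hdisjG, hc0, -, htwin⟩ := hTex'
  have hvol : ∀ f, volume (G f) < ⊤ := fun f => (hfin f).2
  have hPC := stub_polytopeCalculus
  rcases Nat.eq_zero_or_pos n with hn | hn
  · subst hn
    show 6 * (2 : ℝ) ^ ((1 : ℝ) / 3) * (Real.sqrt 2 * (volume (⋃ f : Fin 0, G f)).toReal) ^ ((2 : ℝ) / 3) ≤
      ∑ f : Fin 0, Per (W (A f)) (G f) - ∑ f : Fin 0, ∑ g, (if f = g then 0 else ι (W (A f)) (G f) (G g)) +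
        ∑ f : Fin 0, ∑ g, (if f = g then 0 else c f g / 2 * ι (Dsc (m f g)) (G f) (G g))
    rw [iUnion_of_empty, measure_empty, ENNReal.toReal_zero, mul_zero, Real.zero_rpow (by norm_num),
      mul_zero]
    simp
  have hm₀ : ‖m₀‖ = 1 := by
    obtain ⟨L, -, -, -, -, -, -, hLm, -, -⟩ := hAx ⟨0, hn⟩ ⟨0, hn⟩
    rw [← hLm, LinearIsometryEquiv.norm_map, PiLp.norm_single, norm_one]
  -- the relabelled frames inherit every frame-level hypothesis
  have hAx' : ∀ f g, Ax m₀ (A' f) (A' g) := by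
    intro f g
    obtain ⟨f₁, hf₁⟩ := hA'mem f
    obtain ⟨g₁, hg₁⟩ := hA'mem g
    rw [hf₁, hg₁]; exact hAx f₁ g₁
  have hAx'A : ∀ f g, Ax m₀ (A' f) (A g) := by
    intro f g
    obtain ⟨f₁, hf₁⟩ := hA'mem f
    rw [hf₁]; exact hAx f₁ g
  have hbond' : ∀ f, u ∈ A' f '' Λ := fun f => by obtain ⟨g, hg⟩ := hA'mem f; rw [hg]; exact hbond g
  have hmir' : ∀ f, (ℝ ∙ u)ᗮ.reflection '' (A' f '' Λ) = A' f '' Λ := fun f => by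
    obtain ⟨g, hg⟩ := hA'mem f; rw [hg]; exact hmir g
  have hbond₂' : ∀ f, u₂ ∈ A' f '' Λ := fun f => by obtain ⟨g, hg⟩ := hA'mem f; rw [hg]; exact hbond₂ g
  have hmir₂' : ∀ f, (ℝ ∙ u₂)ᗮ.reflection '' (A' f '' Λ) = A' f '' Λ := fun f => by
    obtain ⟨g, hg⟩ := hA'mem f; rw [hg]; exact hmir₂ g
  have hbond₃' : ∀ f, u₃ ∈ A' f '' Λ := fun f => by obtain ⟨g, hg⟩ := hA'mem f; rw [hg]; exact hbond₃ g
  have hmir₃' : ∀ f, (ℝ ∙ u₃)ᗮ.reflection '' (A' f '' Λ) = A' f '' Λ := fun f => by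
    obtain ⟨g, hg⟩ := hA'mem f; rw [hg]; exact hmir₃ g
  -- the relabelled texture is admissible for the law `(1, 1)` with constant wall data `m₀`
  have hTexR : Tex n G A' (fun _ _ => (1 : ℝ)) (fun _ _ => m₀) := by
    refine ⟨hfin, hdisjG, fun _ _ _ => zero_le_one, ?_, ?_⟩
    · intro f g _ hnot
      exact absurd ⟨m₀, hAx' f g⟩ hnot
    · intro f g _ _ _
      exact ⟨hAx' f g, by norm_num⟩
  -- (1) the free-form slide rung on the relabelled frames
  have R := rung_singleAxis_texture_free k' Hc nv hbd hdisjQ hanti hplane n G A' (fun _ _ => (1 : ℝ))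
    (fun _ _ => m₀) hTexR s hGs hsdisj hcov τ' hτ'1 m₀ u w hAx' hu hw hum hwm hwu hbond' hmir'
  -- abbreviations
  set fa : Fin k' → Fin k' → ℝ := fun a b =>
    facetArea (closure (polytope (Hc a)) ∩ closure (polytope (Hc b))) (nv a b) with hfa
  have hfa0 : ∀ a b, 0 ≤ fa a b := fun a b => ENNReal.toReal_nonneg
  set Sw : ℝ := ∑ f, ∑ g, (if τ' f = τ' g then 0 else ∑ a ∈ s f, ∑ b ∈ s g, |⟪w, nv a b⟫_ℝ| * fa a b)
    with hSw
  set Z : ℝ := ∑ f, ∑ g, (if τ f = τ g then 0 else ∑ a ∈ s f, ∑ b ∈ s g,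
    Real.sqrt (1 - ⟪nv a b, m₀⟫_ℝ ^ 2) * fa a b) with hZ
  set FrD : ℝ := ∑ f ∈ T, (Per (Dsc m₀) (G f) - ∑ g, (if f = g then 0 else ι (Dsc m₀) (G f) (G g))) with hFrD
  -- (2) the sharp twin body change `Fr(A') ≤ Fr(A) + (1/√6)·FrD`
  have hGpoly : ∀ f, ∃ (k : ℕ) (H : Fin k → Finset (E3 × ℝ)), G f = ⋃ i, polytope (H i) := by
    intro f
    refine ⟨(s f).card, fun i => Hc ((s f).equivFin.symm i), ?_⟩
    rw [hGs f]
    ext x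
    simp only [mem_iUnion]
    constructor
    · rintro ⟨j, hj, hx⟩
      exact ⟨(s f).equivFin ⟨j, hj⟩, by simpa using hx⟩
    · rintro ⟨i, hx⟩
      exact ⟨((s f).equivFin.symm i : Fin k'), ((s f).equivFin.symm i).2, hx⟩
  have hWc : ∀ B : E3 ≃ₗᵢ[ℝ] E3, IsCompact (W B) := fun B => isCompact_cruxWulffBody B
  have hWv : ∀ B : E3 ≃ₗᵢ[ℝ] E3, Convex ℝ (W B) := fun B => convex_cruxWulffBody B
  have hW0 : ∀ B : E3 ≃ₗᵢ[ℝ] E3, (0 : E3) ∈ W B := fun B => zero_mem_cruxWulffBody B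
  have hWs : ∀ B : E3 ≃ₗᵢ[ℝ] E3, -W B = W B := fun B => neg_cruxWulffBody_eq B
  have hDc : IsCompact (Dsc m₀) :=
    Metric.isCompact_of_isClosed_isBounded
      ((isClosed_le continuous_norm continuous_const).inter
        (isClosed_eq (continuous_id.inner continuous_const) continuous_const))
      (Metric.isBounded_closedBall.subset (cruxDisc_subset_closedBall m₀))
  have hDs : -Dsc m₀ = Dsc m₀ := by
    show -{y : E3 | ‖y‖ ≤ 1 ∧ ⟪y, m₀⟫_ℝ = 0} = {y : E3 | ‖y‖ ≤ 1 ∧ ⟪y, m₀⟫_ℝ = 0}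
    ext y
    simp only [Set.mem_neg, Set.mem_setOf_eq, norm_neg, inner_neg_left, neg_eq_zero]
  have hgap : ∀ f ∈ T, ∀ ν : E3, supportFn (W (A' f)) ν ≤ supportFn (W (A f)) ν +
      1 / Real.sqrt 6 * supportFn (Dsc m₀) ν := by
    intro f _ ν
    -- `W(A f)` is `W(A' f)` or its mirror image
    rcases cruxWulffBody_eq_or_eq_reflection_image (hAx'A f f) with hEq | hRm
    · -- equal bodies: the gap term is nonnegative
      have h0 : 0 ≤ supportFn (Dsc m₀) ν := by
        unfold supportFn
        exact Literature.Analysis.Convexity.sSup_inner_image_nonneg hDc (zero_mem_cruxDisc m₀) ν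
      have : supportFn (W (A' f)) ν = supportFn (W (A f)) ν := by
        show supportFn {y : E3 | ∀ ν : E3, ⟪y, ν⟫_ℝ ≤ Real.sqrt 2 / 4 *
            ∑ᶠ w ∈ {w | w ∈ fccStacking 1 (Real.sqrt (2 / 3)) ∧ ‖w‖ = 1}, |⟪w, (A' f).symm ν⟫_ℝ|} ν =
          supportFn {y : E3 | ∀ ν : E3, ⟪y, ν⟫_ℝ ≤ Real.sqrt 2 / 4 *
            ∑ᶠ w ∈ {w | w ∈ fccStacking 1 (Real.sqrt (2 / 3)) ∧ ‖w‖ = 1}, |⟪w, (A f).symm ν⟫_ℝ|} ν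
        rw [hEq]
      rw [this]
      linarith [mul_nonneg (by positivity : (0:ℝ) ≤ 1 / Real.sqrt 6) h0]
    · obtain ⟨g, hg⟩ := hA'mem f
      have hself : Ax m₀ (A' f) (A' f) := hAx' f f
      have h := supportFn_le_twin_disc hself (hbond' f) hu hum hw hwm hwu (hmir' f) hw₂ hw₃
        (hbond₂' f) hu₂ hu₂m hwu₂ (hmir₂' f) (hbond₃' f) hu₃ hu₃m hwu₃ (hmir₃' f) ν
      show supportFn {y : E3 | ∀ ν : E3, ⟪y, ν⟫_ℝ ≤ Real.sqrt 2 / 4 *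
          ∑ᶠ w ∈ {w | w ∈ fccStacking 1 (Real.sqrt (2 / 3)) ∧ ‖w‖ = 1}, |⟪w, (A' f).symm ν⟫_ℝ|} ν ≤
        supportFn {y : E3 | ∀ ν : E3, ⟪y, ν⟫_ℝ ≤ Real.sqrt 2 / 4 *
          ∑ᶠ w ∈ {w | w ∈ fccStacking 1 (Real.sqrt (2 / 3)) ∧ ‖w‖ = 1}, |⟪w, (A f).symm ν⟫_ℝ|} ν +
        1 / Real.sqrt 6 * supportFn {y : E3 | ‖y‖ ≤ 1 ∧ ⟪y, m₀⟫_ℝ = 0} ν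
      rw [hRm]
      exact h
  have hBC := freeEnergy_bodyChange_le_add G hGpoly hvol hdisjG (fun f => W (A f)) (fun f => hWc (A f))
    (fun f => hWv (A f)) (fun f => hW0 (A f)) (fun f => hWs (A f)) (fun f => W (A' f))
    (fun f => hWc (A' f)) (fun f => hWv (A' f)) (fun f => hW0 (A' f)) (fun f => hWs (A' f))
    (Dsc m₀) hDc (convex_cruxDisc m₀) (zero_mem_cruxDisc m₀) hDs (c := 1 / Real.sqrt 6) T
    (fun f hf => by show W (A' f) = W (A f); rw [hA'T f hf]) hgap
  -- (3) the walls of the texture pay `¼ Z`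
  have hwall : (1 : ℝ) / 4 * Z ≤ ∑ f, ∑ g, (if f = g then 0 else c f g / 2 * ι (Dsc (m f g)) (G f) (G g)) := by
    rw [hZ, Finset.mul_sum]
    refine Finset.sum_le_sum fun f _ => ?_
    rw [Finset.mul_sum]
    refine Finset.sum_le_sum fun g _ => ?_
    by_cases hfg : f = g
    · subst hfg; simp
    · rw [if_neg hfg]
      have hDc' : IsCompact (Dsc (m f g)) :=
        Metric.isCompact_of_isClosed_isBounded
          ((isClosed_le continuous_norm continuous_const).inter
            (isClosed_eq (continuous_id.inner continuous_const) continuous_const))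
          (Metric.isBounded_closedBall.subset (cruxDisc_subset_closedBall (m f g)))
      have hι0 : 0 ≤ ι (Dsc (m f g)) (G f) (G g) := by
        show 0 ≤ (Per (Dsc (m f g)) (G f) + Per (Dsc (m f g)) (G g) - Per (Dsc (m f g)) (G f ∪ G g)) / 2
        have h := iota_nonneg_of_poly G hGpoly hvol hdisjG hDc' (convex_cruxDisc (m f g))
          (zero_mem_cruxDisc (m f g)) hfg
        exact div_nonneg h (by norm_num)
      by_cases hτfg : τ f = τ g
      · rw [if_pos hτfg, mul_zero]
        exact mul_nonneg (div_nonneg (hc0 f g hfg) (by norm_num)) hι0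
      · rw [if_neg hτfg]
        have hmfg : m f g = m₀ := hmax f g hfg hτfg
        have hc12 : 1 / 2 ≤ c f g := (htwin f g hfg ⟨m₀, hAx f g⟩ (hτ2 f g hτfg)).2
        have hιlow : ∑ a ∈ s f, ∑ b ∈ s g, Real.sqrt (1 - ⟪nv a b, m₀⟫_ℝ ^ 2) * fa a b ≤
            ι (Dsc m₀) (G f) (G g) := by
          have h := sinSum_le_iota_of_polytopeCalculus hPC hm₀ Hc nv hbd hdisjQ hanti hplane
            (hsdisj f g hfg)
          have e1 : (⋃ j ∈ s f, polytope (Hc j)) = G f := (hGs f).symm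
          have e2 : (⋃ j ∈ s g, polytope (Hc j)) = G g := (hGs g).symm
          have e3 : (⋃ j ∈ s f ∪ s g, polytope (Hc j)) = G f ∪ G g := by
            rw [Finset.set_biUnion_union, e1, e2]
          rw [e1, e2, e3] at h
          exact h
        rw [hmfg]
        have hZfg0 : 0 ≤ ∑ a ∈ s f, ∑ b ∈ s g, Real.sqrt (1 - ⟪nv a b, m₀⟫_ℝ ^ 2) * fa a b :=
          Finset.sum_nonneg fun a _ => Finset.sum_nonneg fun b _ =>
            mul_nonneg (Real.sqrt_nonneg _) (hfa0 a b)
        rw [hmfg] at hι0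
        nlinarith [hιlow, hc12, hι0, hZfg0]
  -- (4) assemble
  show 6 * (2 : ℝ) ^ ((1 : ℝ) / 3) * (Real.sqrt 2 * (volume (⋃ f, G f)).toReal) ^ ((2 : ℝ) / 3) ≤
    ∑ f, Per (W (A f)) (G f) - ∑ f, ∑ g, (if f = g then 0 else ι (W (A f)) (G f) (G g)) +
      ∑ f, ∑ g, (if f = g then 0 else c f g / 2 * ι (Dsc (m f g)) (G f) (G g))
  have hR : 6 * (2 : ℝ) ^ ((1 : ℝ) / 3) * (Real.sqrt 2 * (volume (⋃ f, G f)).toReal) ^ ((2 : ℝ) / 3) ≤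
      (∑ f, Per (W (A' f)) (G f) - ∑ f, ∑ g, (if f = g then 0 else ι (W (A' f)) (G f) (G g))) +
        1 / Real.sqrt 6 * Sw := R
  have hBC' : (∑ f, Per (W (A' f)) (G f) - ∑ f, ∑ g, (if f = g then 0 else ι (W (A' f)) (G f) (G g))) ≤
      (∑ f, Per (W (A f)) (G f) - ∑ f, ∑ g, (if f = g then 0 else ι (W (A f)) (G f) (G g))) +
        1 / Real.sqrt 6 * FrD := by
    have e : ∀ (B : Fin n → (E3 ≃ₗᵢ[ℝ] E3)),
        (∑ f, Per (W (B f)) (G f) - ∑ f, ∑ g, (if f = g then 0 else ι (W (B f)) (G f) (G g))) =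
        ∑ f, (per (W (B f)) (G f) - ∑ g, (if f = g then 0 else
          (per (W (B f)) (G f) + per (W (B f)) (G g) - per (W (B f)) (G f ∪ G g)) / 2)) := by
      intro B
      rw [← Finset.sum_sub_distrib]
      rfl
    rw [e A', e A]
    exact hBC
  have h6 : (0 : ℝ) < Real.sqrt 6 := Real.sqrt_pos.2 (by norm_num)
  have hY : 1 / Real.sqrt 6 * Sw + 1 / Real.sqrt 6 * FrD ≤ (1 : ℝ) / 4 * Z := by
    have e : 1 / Real.sqrt 6 * Sw + 1 / Real.sqrt 6 * FrD = (1 / 2) * (2 / Real.sqrt 6 * (Sw + FrD)) := by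
      ring
    rw [e]
    linarith only [hHyb]
  linarith only [hR, hBC', hY, hwall]

/-- **Flip-a-class corollary** (`rung_singleAxis_texture_flipClass`): NO azimuth condition.  If the
sin-weighted free `Dsc m₀`-area of ONE lattice class, times `2/√6`, is at most the sin-weighted twin-wall
area (`½·Σ_{τ f ≠ τ g} Σ √(1 − ⟪ν, m₀⟫²)·fa`, i.e. physically: `(1/√6)·Fr_{Dsc}(class) ≤` the twin-wall
ENERGY at the law `½`), then `6·2^{1/3}(√2·Vol)^{2/3} ≤ En`.  Covers the `W_min` centre-cone textures of
the gen-10 residual. -/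
theorem rung_singleAxis_texture_flipClass :
    let Λ : Set (EuclideanSpace ℝ (Fin 3)) := Literature.MathematicalPhysics.StatisticalMechanics.fccStacking 1 (Real.sqrt (2 / 3));
    let Brl : (ℤ → ℤ) → Set (EuclideanSpace ℝ (Fin 3)) := Literature.MathematicalPhysics.StatisticalMechanics.barlowStacking 1 (Real.sqrt (2 / 3));
    let Ax : EuclideanSpace ℝ (Fin 3) → (EuclideanSpace ℝ (Fin 3) ≃ₗᵢ[ℝ] EuclideanSpace ℝ (Fin 3)) → (EuclideanSpace ℝ (Fin 3) ≃ₗᵢ[ℝ] EuclideanSpace ℝ (Fin 3)) → Prop := fun m A B => ∃ (L : EuclideanSpace ℝ (Fin 3) ≃ₗᵢ[ℝ] EuclideanSpace ℝ (Fin 3)) (s₁ s₂ : EuclideanSpace ℝ (Fin 3)) (σ σ' : ℤ → ℤ), Literature.MathematicalPhysics.StatisticalMechanics.IsHaggSeq σ ∧ Literature.MathematicalPhysics.StatisticalMechanics.IsHaggSeq σ' ∧ L (EuclideanSpace.single (2 : Fin 3) (1 : ℝ)) = m ∧ A '' Λ ⊆ (fun q => L q + s₁) '' Brl σ ∧ B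 '' Λ ⊆ (fun q => L q + s₂) '' Brl σ';
    let CoAx : (EuclideanSpace ℝ (Fin 3) ≃ₗᵢ[ℝ] EuclideanSpace ℝ (Fin 3)) → (EuclideanSpace ℝ (Fin 3) ≃ₗᵢ[ℝ] EuclideanSpace ℝ (Fin 3)) → Prop := fun A B => ∃ m, Ax m A B;
    let Φ : EuclideanSpace ℝ (Fin 3) → ℝ := fun ν => Real.sqrt 2 / 4 * ∑ᶠ w ∈ {w ∈ Λ | ‖w‖ = 1}, |⟪w, ν⟫_ℝ|;
    let Per : Set (EuclideanSpace ℝ (Fin 3)) → Set (EuclideanSpace ℝ (Fin 3)) → ℝ := fun K S => (⨆ (ξ : EuclideanSpace ℝ (Fin 3) → EuclideanSpace ℝ (Fin 3)) (_ : ContDiff ℝ 1 ξ ∧ HasCompactSupport ξ ∧ ∀ z, ξ z ∈ K), ENNReal.ofReal (∫ z in S, Literature.MathematicalPhysics.StatisticalMechanics.fieldDivergence ξ z)).toReal;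
    let ι : Set (EuclideanSpace ℝ (Fin 3)) → Set (EuclideanSpace ℝ (Fin 3)) → Set (EuclideanSpace ℝ (Fin 3)) → ℝ := fun K S₁ S₂ => (Per K S₁ + Per K S₂ - Per K (S₁ ∪ S₂)) / 2;
    let W : (EuclideanSpace ℝ (Fin 3) ≃ₗᵢ[ℝ] EuclideanSpace ℝ (Fin 3)) → Set (EuclideanSpace ℝ (Fin 3)) := fun A => {y | ∀ ν : EuclideanSpace ℝ (Fin 3), ⟪y, ν⟫_ℝ ≤ Φ (A.symm ν)};
    let Dsc : EuclideanSpace ℝ (Fin 3) → Set (EuclideanSpace ℝ (Fin 3)) := fun m => {y | ‖y‖ ≤ 1 ∧ ⟪y, m⟫_ℝ = 0};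
    let Tex : (n : ℕ) → (Fin n → Set (EuclideanSpace ℝ (Fin 3))) → (Fin n → (EuclideanSpace ℝ (Fin 3) ≃ₗᵢ[ℝ] EuclideanSpace ℝ (Fin 3))) → (Fin n → Fin n → ℝ) → (Fin n → Fin n → EuclideanSpace ℝ (Fin 3)) → Prop := fun n G A c m => (∀ f : Fin n, Literature.MathematicalPhysics.StatisticalMechanics.HasFinitePerimeter (G f) ∧ volume (G f) < ⊤) ∧ (∀ f g, f ≠ g → Disjoint (G f) (G g)) ∧ (∀ f g, f ≠ g → 0 ≤ c f g) ∧ (∀ f g, f ≠ g → ¬ CoAx (A f) (A g) → m f g = 0 ∧ 1 ≤ c f g) ∧ (∀ f g, f ≠ g → CoAx (A f) (A g) → A f '' Λ ≠ A g '' Λ → Ax (m f g) (A f) (A g) ∧ 1 / 2 ≤ c f g);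
    let En : (n : ℕ) → (Fin n → Set (EuclideanSpace ℝ (Fin 3))) → (Fin n → (EuclideanSpace ℝ (Fin 3) ≃ₗᵢ[ℝ] EuclideanSpace ℝ (Fin 3))) → (Fin n → Fin n → ℝ) → (Fin n → Fin n → EuclideanSpace ℝ (Fin 3)) → ℝ := fun n G A c m => ∑ f : Fin n, Per (W (A f)) (G f) - ∑ f, ∑ g, (if f = g then 0 else ι (W (A f)) (G f) (G g)) + ∑ f, ∑ g, (if f = g then 0 else c f g / 2 * ι (Dsc (m f g)) (G f) (G g));
    let Vol : (n : ℕ) → (Fin n → Set (EuclideanSpace ℝ (Fin 3))) → ℝ := fun n G => (volume (⋃ f : Fin n, G f)).toReal;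
    ∀ (k' : ℕ) (Hc : Fin k' → Finset ((EuclideanSpace ℝ (Fin 3)) × ℝ)) (nv : Fin k' → Fin k' → EuclideanSpace ℝ (Fin 3)),
      (∀ j, Bornology.IsBounded (polytope (Hc j))) →
      (∀ j j', j ≠ j' → Disjoint (polytope (Hc j)) (polytope (Hc j'))) →
      (∀ i j, nv j i = -nv i j) →
      (∀ j j', j ≠ j' → ‖nv j j'‖ = 1 ∧ ∃ b : ℝ,
        closure (polytope (Hc j)) ∩ closure (polytope (Hc j')) ⊆ {x | ⟪nv j j', x⟫_ℝ = b}) →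
    ∀ (n : ℕ) (G : Fin n → Set (EuclideanSpace ℝ (Fin 3)))
      (A : Fin n → (EuclideanSpace ℝ (Fin 3) ≃ₗᵢ[ℝ] EuclideanSpace ℝ (Fin 3)))
      (c : Fin n → Fin n → ℝ) (m : Fin n → Fin n → EuclideanSpace ℝ (Fin 3)),
      Tex n G A c m →
    ∀ (s : Fin n → Finset (Fin k')),
      (∀ f, G f = ⋃ j ∈ s f, polytope (Hc j)) →
      (∀ f g, f ≠ g → Disjoint (s f) (s g)) →
      (∀ j, ∃ f, j ∈ s f) →
    ∀ (τ : Fin n → Bool), (∀ f g, τ f = τ g → A f '' Λ = A g '' Λ) → (∀ f g, τ f ≠ τ g → A f '' Λ ≠ A g '' Λ) →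
    ∀ (m₀ u w : EuclideanSpace ℝ (Fin 3)), (∀ f g, Ax m₀ (A f) (A g)) → (∀ f g, f ≠ g → τ f ≠ τ g → m f g = m₀) →
      ‖u‖ = 1 → ‖w‖ = 1 → ⟪u, m₀⟫_ℝ = 0 → ⟪w, m₀⟫_ℝ = 0 → ⟪w, u⟫_ℝ = 0 →
      (∀ f, u ∈ A f '' Λ) → (∀ f, (ℝ ∙ u)ᗮ.reflection '' (A f '' Λ) = A f '' Λ) →
    ∀ (u₂ w₂ u₃ w₃ : EuclideanSpace ℝ (Fin 3)),
      w₂ = (Real.sqrt 3 / 2) • u - (1 / 2 : ℝ) • w → w₃ = -(Real.sqrt 3 / 2) • u - (1 / 2 : ℝ) • w →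
      ‖u₂‖ = 1 → ⟪u₂, m₀⟫_ℝ = 0 → ⟪w₂, u₂⟫_ℝ = 0 →
      (∀ f, u₂ ∈ A f '' Λ) → (∀ f, (ℝ ∙ u₂)ᗮ.reflection '' (A f '' Λ) = A f '' Λ) →
      ‖u₃‖ = 1 → ⟪u₃, m₀⟫_ℝ = 0 → ⟪w₃, u₃⟫_ℝ = 0 →
      (∀ f, u₃ ∈ A f '' Λ) → (∀ f, (ℝ ∙ u₃)ᗮ.reflection '' (A f '' Λ) = A f '' Λ) →
    ∀ (b : Bool) (g₀ : Fin n), τ g₀ ≠ b →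
      2 / Real.sqrt 6 * ∑ f ∈ Finset.univ.filter (fun f => τ f = b),
          (Per (Dsc m₀) (G f) - ∑ g, (if f = g then 0 else ι (Dsc m₀) (G f) (G g))) ≤
        1 / 2 * ∑ f, ∑ g, (if τ f = τ g then 0 else ∑ a ∈ s f, ∑ b ∈ s g,
          Real.sqrt (1 - ⟪nv a b, m₀⟫_ℝ ^ 2) * facetArea (closure (polytope (Hc a)) ∩ closure (polytope (Hc b))) (nv a b)) →
    6 * (2 : ℝ) ^ ((1 : ℝ) / 3) * (Real.sqrt 2 * Vol n G) ^ ((2 : ℝ) / 3) ≤ En n G A c m := by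
  intro Λ Brl Ax CoAx Φ Per ι W Dsc Tex En Vol k' Hc nv hbd hdisjQ hanti hplane n G A c m hTex
    s hGs hsdisj hcov τ hτ1 hτ2 m₀ u w hAx hmax hu hw hum hwm hwu hbond hmir
    u₂ w₂ u₃ w₃ hw₂ hw₃ hu₂ hu₂m hwu₂ hbond₂ hmir₂ hu₃ hu₃m hwu₃ hbond₃ hmir₃ b g₀ hg₀ htest
  classical
  refine rung_singleAxis_texture_hybrid k' Hc nv hbd hdisjQ hanti hplane n G A c m hTex s hGs hsdisj hcov
    τ hτ1 hτ2 m₀ u w hAx hmax hu hw hum hwm hwu hbond hmir u₂ w₂ u₃ w₃ hw₂ hw₃ hu₂ hu₂m hwu₂ hbond₂ hmir₂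
    hu₃ hu₃m hwu₃ hbond₃ hmir₃ (fun f => if τ f = b then A g₀ else A f) (fun _ => true)
    (Finset.univ.filter (fun f => τ f = b)) ?_ ?_ ?_ ?_
  · intro f hf
    have h : ¬ τ f = b := by simpa using hf
    simp only [h, if_false]
  · intro f
    by_cases h : τ f = b
    · exact ⟨g₀, by simp only [h, if_true]⟩
    · exact ⟨f, by simp only [h, if_false]⟩
  · intro f g _
    -- grains outside the flipped class share the lattice of `g₀`
    have hcls : ∀ f, ¬ τ f = b →
        A f '' fccStacking 1 (Real.sqrt (2 / 3)) = A g₀ '' fccStacking 1 (Real.sqrt (2 / 3)) := by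
      intro f h
      apply hτ1
      revert h hg₀
      cases τ f <;> cases τ g₀ <;> cases b <;> simp
    by_cases hf : τ f = b
    · by_cases hg : τ g = b
      · rw [if_pos hf, if_pos hg]
      · rw [if_pos hf, if_neg hg]; exact (hcls g hg).symm
    · by_cases hg : τ g = b
      · rw [if_neg hf, if_pos hg]; exact hcls f hf
      · rw [if_neg hf, if_neg hg]; exact (hcls f hf).trans (hcls g hg).symm
  · have hSw : (∑ f, ∑ g, (if (fun _ : Fin n => true) f = (fun _ : Fin n => true) g then (0 : ℝ) else
        ∑ a ∈ s f, ∑ b ∈ s g, |⟪w, nv a b⟫_ℝ| *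
          facetArea (closure (polytope (Hc a)) ∩ closure (polytope (Hc b))) (nv a b))) = 0 := by
      simp
    rw [hSw, zero_add]
    exact htest

end Summit.Ventures.Crystal3D.Cruxes.PolycrystalWulffBound.PolyDensity

end
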